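import Literature.AlgebraicGeometry.Motives.CompleteIntersectionChowGroupsProofs
import Literature.AlgebraicGeometry.Motives.LinesInProjectiveSpace
import Literature.AlgebraicGeometry.Motives.LinearSubspacesGenerateChow
import Literature.RingTheory.MvPolynomial.VanishingOnSubspace
import Mathlib.AlgebraicGeometry.AlgClosed.Basic
import HarnessLib

/-!
# Lines and planes through every closed point of a complete intersection of small degree (ELV Lemma 4.2 a) on schemes)

Helper results for the named fact
`Literature.AlgebraicGeometry.Motives.EsnaultLevineViehweg1997_chowGroup_rank_le_one`
(`Motives/CompleteIntersectionChowGroups`), continuing `Motives/CompleteIntersectionChowGroupsProofs`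
(H. Esnault, M. Levine, E. Viehweg, *Chow groups of projective varieties of very small degree*,
Duke Math. J. **87** (1997) 29–58 [EsnaultLevineViehweg1997], §1 Lemma 1.1 and §4 Lemma 4.2 a):
"for each `v ∈ V(n; d₁, …, d_r)_k` and for each point `x ∈ X_v` there exists an `l`-plane
`H ∈ Gr_k(l; X_v)` which contains `x`").

That file proves the statement in homogeneous coordinates
(`EsnaultLevineViehweg.exists_linearIndependent_lineRestrict_eq_zero`: for `Σⱼ dⱼ ≤ N - 1` and a
non-zero common zero `p` of the `Fⱼ` there is `v`, independent from `p`, with every `Fⱼ` vanishing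
identically on `span(p, v)`). Here it is transported to the tree's SCHEMES, in the vocabulary of
`Motives/LinesGenerateChowOne` / `Motives/LinesInProjectiveSpace` (`IsLinePoint N i z`: a point `z`
of `X` of dimension `1` whose closure is mapped by the closed immersion `i : X ↪ ℙᴺ_k` onto a line
`V₊(L₁, …, L_{N-1})`):

* `EsnaultLevineViehweg.exists_isLinePoint_of_isClosed` — **for a closed `k`-immersion
  `i : X ↪ ℙᴺ_k` (`k` algebraically closed, `X` locally of finite type) with image
  `V₊(F₁, …, F_r)`, `deg Fⱼ = dⱼ ≥ 1`, `Σⱼ dⱼ ≤ N - 1`, every closed point `x` of `X` lies on a line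
  of `X`**: `∃ z, IsLinePoint N i z ∧ x ∈ closure {z}`;
* `EsnaultLevineViehweg.exists_forall_isLinePoint_of_isCutOutBy`,
  `EsnaultLevineViehweg.exists_forall_isLinePoint_of_isSmoothCompleteIntersection` — the same for
  the carriers `IsCutOutBy` / `IsSmoothCompleteIntersection m d X` of `Motives/CompleteIntersection`;
  `EsnaultLevineViehweg.exists_isLinePoint_of_isClosed_quadricCubic` — the `(2,3) ⊂ ℙ⁸` instance in
  the rendering of route `HodgeConjecture/schlafli-minus-five` (image `V₊(Q, C)`; `2 + 3 + 1 ≤ 8`).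

Assembly (all ingredients are in the tree): a closed point of a `k`-scheme locally of finite type
over `k = k̄` underlies a `k`-point (`exists_algPoints_pt_eq`: Jacobson schemes, Mathlib
`isFinite_iff_locallyOfFiniteType_of_jacobsonSpace`, and `IsAlgClosed.lift`), whose image in `ℙᴺ`
has homogeneous coordinates `p` (`ProjectiveSpace.exists_eq_pointOfVec`,
`Motives/ProjectiveSpaceFieldPointsBijective`) on which the `Fⱼ` vanish
(`ProjectiveSpace.pt_pointOfVec_mem_zeroLocus_iff`); the coordinate statement gives `v`; the
`N - 1` coordinate forms of a basis extending `(p, v)` cut out `span(p, v)` and contain every `Fⱼ`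
in their ideal (`exists_linearForms_forall_mem_ideal_span`, the family version of
`Literature.RingTheory.MvPolynomial.exists_linearForms_mem_ideal_span_of_forall_eval_eq_zero`), so
the line they define lies on `i(X) = V₊(F)` and is the image of the closure of a line point of `X`
(`exists_isLinePoint_of_zeroLocus_subset`, `Motives/LinesInProjectiveSpace`), which passes through
`x` since the forms vanish at `p`.

* `EsnaultLevineViehweg.exists_isLinearSubspacePoint_of_isClosed`,
  `EsnaultLevineViehweg.exists_forall_isLinearSubspacePoint_of_isSmoothCompleteIntersection` — **the
  same for `l`-planes** (`IsLinearSubspacePoint l N i z` of `Motives/LinearSubspacesGenerateChow`)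
  under ELV's count `Σⱼ C(dⱼ + l - 1, l) ≤ N - l`, resp. under the printed hypothesis (13) of
  Thm. 4.6 / Lemma 4.2 (`dⱼ ≥ 2`, `some dⱼ ≥ 3` or `c ≥ l`, `Σⱼ C(dⱼ + l, l + 1) ≤ N`), via the
  `r`-plane analogue `exists_isLinearSubspacePoint_of_zeroLocus_subset` of
  `exists_isLinePoint_of_zeroLocus_subset`. This is exactly **Lemma 4.2 a)** of [ELV] on the carriers
  of the named fact.

What is NOT here: any statement about Chow groups (two closed points on a line of `X` have the same
class in `CH₀(X)` — needs the divisor of a ratio of linear forms on the line), Lemma 4.2 b)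
(irreducibility of the Fano scheme), and the Fano schemes themselves (`Motives/FanoSchemeOfPlanes`
defines them; their field-valued points are the planes found here).

## References

* [EsnaultLevineViehweg1997] H. Esnault, M. Levine, E. Viehweg, Duke Math. J. 87 (1997) 29–58:
  §1 Lemma 1.1, §4 Lemma 4.2 a).
* [Hartshorne1977] R. Hartshorne, *Algebraic Geometry* (1977): I Ex. 2.11 (linear varieties),
  II Ex. 2.14 (points of `ℙⁿ`), as used by `Motives/LinesInProjectiveSpace` and
  `Motives/ProjectiveSpaceFieldPoints`.
-/

noncomputable section

open MvPolynomial AlgebraicGeometry CategoryTheory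

universe u

namespace Literature.AlgebraicGeometry.Motives

namespace EsnaultLevineViehweg

/-! ### Linear forms cutting out the span of an independent family, adapted to a family of
polynomials vanishing on it -/

section LinearForms

open Literature.RingTheory.MvPolynomial

variable {k : Type u} [Field k] {N u : ℕ}

/-- **Polynomials vanishing on the span of an independent family lie in the ideal of the
complementary coordinate forms** (family version of
`Literature.RingTheory.MvPolynomial.exists_linearForms_mem_ideal_span_of_forall_eval_eq_zero`, with
the same proof): for `w₀, …, w_{u-1}` linearly independent in `kᴺ⁺¹` (`k` infinite) there are
`t = N + 1 - u` linearly independent linear forms `L₁, …, L_t` VANISHING ON `span(w)` such that every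
polynomial `F_j` vanishing on `span(w)` lies in `(L₁, …, L_t)` (the coordinate forms, along the new
vectors, of a basis extending the `w_j`). [folklore] -/
theorem exists_linearForms_forall_mem_ideal_span [Infinite k] {ι' : Type*}
    (F : ι' → MvPolynomial (Fin (N + 1)) k) {w : Fin u → Fin (N + 1) → k}
    (hw : LinearIndependent k w)
    (hv : ∀ j, ∀ v ∈ Submodule.span k (Set.range w), eval v (F j) = 0) :
    ∃ (t : ℕ) (L : Fin t → MvPolynomial (Fin (N + 1)) k), t + u = N + 1 ∧
      LinearIndependent k L ∧ (∀ j, (L j).IsHomogeneous 1) ∧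
        (∀ j, F j ∈ Ideal.span (Set.range L)) ∧
          ∀ j, ∀ v ∈ Submodule.span k (Set.range w), eval v (L j) = 0 := by
  classical
  -- extend `w` to a basis `b`, indexed by a set `E ⊇ range w` of vectors, `b i = i`
  have hli : LinearIndepOn k id (Set.range w) := hw.linearIndepOn_id
  have hsub : Set.range w ⊆ hli.extend (Set.subset_univ _) := hli.subset_extend _
  set b := Module.Basis.extend hli with hb_def
  have hb : ∀ i, b i = (i : Fin (N + 1) → k) := Module.Basis.extend_apply_self hli
  haveI : Fintype ↥(hli.extend (Set.subset_univ _)) := FiniteDimensional.fintypeBasisIndex b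
  -- the new basis vectors
  set T : Set ↥(hli.extend (Set.subset_univ _)) :=
    {i | (i : Fin (N + 1) → k) ∉ Set.range w} with hT
  -- each `F j` lies in the ideal of the coordinate forms along `T`
  have hmem : ∀ j, F j ∈ Ideal.span
      ((fun i => ∑ m : Fin (N + 1), C (b.repr (Pi.single m 1) i) * X m) '' T) := by
    intro j
    refine mem_ideal_span_coordForm_of_forall_eval_eq_zero b T (F j) fun c hc => ?_
    have hfun : (fun m => ∑ i, c i * b i m) = ∑ i, c i • (b i : Fin (N + 1) → k) := by
      funext m
      simp [Finset.sum_apply, Pi.smul_apply]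
    rw [hfun]
    refine hv j _ (Submodule.sum_mem _ fun i _ => ?_)
    by_cases hi : i ∈ T
    · rw [hc i hi, zero_smul]
      exact Submodule.zero_mem _
    · refine Submodule.smul_mem _ _ (Submodule.subset_span ?_)
      rw [hb]
      simpa [hT] using hi
  -- the coordinate forms along `T` vanish on `span w`
  have hvan : ∀ i ∈ T, ∀ v ∈ Submodule.span k (Set.range w),
      eval v (∑ m : Fin (N + 1), C (b.repr (Pi.single m 1) i) * X m) = 0 := by
    intro i hi v hvw
    rw [eval_coordForm]
    have hspan : Submodule.span k (Set.range w) ≤ Submodule.span k (b '' Tᶜ) := by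
      refine Submodule.span_le.mpr ?_
      rintro _ ⟨j, rfl⟩
      refine Submodule.subset_span ⟨⟨w j, hsub ⟨j, rfl⟩⟩, ?_, ?_⟩
      · simp [hT]
      · rw [hb]
    have hsupp := b.repr_support_subset_of_mem_span (Tᶜ) (hspan hvw)
    by_contra hne
    exact (hsupp (Finsupp.mem_support_iff.mpr hne)) hi
  -- counting: `#E = N + 1`, `#Tᶜ = u`
  have hcardE : Fintype.card ↥(hli.extend (Set.subset_univ _)) = N + 1 := by
    have h := Module.finrank_eq_card_basis b
    rwa [Module.finrank_fin_fun, eq_comm] at h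
  have eT : ↥Tᶜ ≃ Fin u :=
    { toFun := fun i => (Equiv.ofInjective w hw.injective).symm
        ⟨(i.1 : Fin (N + 1) → k), by simpa [hT] using i.2⟩
      invFun := fun j => ⟨⟨w j, hsub ⟨j, rfl⟩⟩, by simp [hT]⟩
      left_inv := fun i => by
        apply Subtype.ext
        apply Subtype.ext
        exact Equiv.apply_ofInjective_symm hw.injective _
      right_inv := fun j => by
        simp only
        exact Equiv.ofInjective_symm_apply hw.injective j }
  have hcardTc : Fintype.card ↥Tᶜ = u := (Fintype.card_congr eT).trans (Fintype.card_fin u)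
  have hcompl := Fintype.card_compl_set T
  have hle : Fintype.card ↥T ≤ Fintype.card ↥(hli.extend (Set.subset_univ _)) :=
    set_fintype_card_le_univ T
  -- reindex `T` by `Fin t`
  let e : Fin (Fintype.card ↥T) ≃ ↥T := (Fintype.equivFin ↥T).symm
  refine ⟨Fintype.card ↥T,
    fun j => ∑ m : Fin (N + 1), C (b.repr (Pi.single m 1) (e j : ↥(hli.extend _))) * X m,
    by omega, ?_, fun j => isHomogeneous_coordForm b _, ?_, fun j v hvw => hvan _ (e j).2 v hvw⟩
  · exact ((linearIndependent_coordForm b).comp _ Subtype.val_injective).comp _ e.injective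
  · have hrange : Set.range (fun j => ∑ m : Fin (N + 1),
        C (b.repr (Pi.single m 1) (e j : ↥(hli.extend (Set.subset_univ _)))) * X m) =
        (fun i => ∑ m : Fin (N + 1), C (b.repr (Pi.single m 1) i) * X m) '' T := by
      ext p
      simp only [Set.mem_range, Set.mem_image]
      constructor
      · rintro ⟨j, rfl⟩
        exact ⟨e j, (e j).2, rfl⟩
      · rintro ⟨i, hi, rfl⟩
        exact ⟨e.symm ⟨i, hi⟩, by simp⟩
    intro j
    rw [hrange]
    exact hmem j

end LinearForms

/-! ### Closed points of a `k`-scheme over `k = k̄` are `k`-rational -/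

section ClosedPoints

variable {k : Type u} [Field k] [IsAlgClosed k] {X : SchemeOver k}

/-- Over an algebraically closed field `k`, every closed point of a `k`-scheme locally of finite
type underlies a `k`-rational point: `κ(x)` is finite over `k` (the scheme is Jacobson, Stacks
01TB, Mathlib `isFinite_iff_locallyOfFiniteType_of_jacobsonSpace`), hence admits a `k`-embedding
into `k = k̄` (same argument as `exists_point_through_closedPoint` of `Motives/AlgPointsSeparate`,
repeated here to keep the imports of this file inside algebraic geometry). [folklore] -/
theorem exists_algPoints_pt_eq [LocallyOfFiniteType X.hom] {x : ↥X.left}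
    (hx : IsClosed ({x} : Set ↥X.left)) : ∃ P : AlgPoints X k, P.pt = x := by
  -- `κ(x)` is finite over `k`
  set φ := Spec.preimage (X.left.fromSpecResidueField x ≫ X.hom) with hφdef
  have hφ : Spec.map φ = X.left.fromSpecResidueField x ≫ X.hom := Spec.map_preimage _
  have hfinite : φ.hom.Finite := by
    have : JacobsonSpace ↥X.left := LocallyOfFiniteType.jacobsonSpace X.hom
    have := isClosed_singleton_iff_isClosedImmersion.mp hx
    have hfin : IsFinite (X.left.fromSpecResidueField x ≫ X.hom) :=
      isFinite_iff_locallyOfFiniteType_of_jacobsonSpace.mpr inferInstance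
    rw [← hφ, IsFinite.SpecMap_iff] at hfin
    exact hfin
  letI : Algebra k (X.left.residueField x) := φ.hom.toAlgebra
  have : Module.Finite k (X.left.residueField x) := hfinite
  -- a `k`-embedding `κ(x) → k`
  let τ : X.left.residueField x →ₐ[k] k := IsAlgClosed.lift
  have hτ : (Spec.map (CommRingCat.ofHom τ.toRingHom) ≫ X.left.fromSpecResidueField x) ≫ X.hom =
      Spec.map (CommRingCat.ofHom (algebraMap k k)) := by
    rw [Category.assoc, ← hφ, ← Spec.map_comp]
    congr 1
    ext a
    exact τ.commutes a
  refine ⟨AlgPoints.mk (Spec.map (CommRingCat.ofHom τ.toRingHom) ≫ X.left.fromSpecResidueField x)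
    hτ, ?_⟩
  change (Spec.map (CommRingCat.ofHom τ.toRingHom) ≫ X.left.fromSpecResidueField x).base _ = x
  rw [Scheme.Hom.comp_base, TopCat.coe_comp, Function.comp_apply, Scheme.fromSpecResidueField_apply]

end ClosedPoints

/-! ### Lines through every closed point of an embedded scheme -/

section EmbeddedLines

variable {k : Type u} [Field k] {N : ℕ}

-- No `attribute [local instance] MvPolynomial.gradedAlgebra` and no notation here: the statements
-- mentioning `V₊(…) = ProjectiveSpectrum.zeroLocus …` supply the grading by an inline `letI`, which
-- elaborates to the same terms as in `Motives/LinesGenerateChowOne` and the route files.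

/-- `FanoScheme.lineRestrict p v g = 0` makes `g` vanish at every vector of `span(p, v)`.
[folklore] -/
theorem eval_eq_zero_of_lineRestrict_eq_zero {p v : Fin (N + 1) → k}
    {g : MvPolynomial (Fin (N + 1)) k} (hg : FanoScheme.lineRestrict p v g = 0)
    {w : Fin (N + 1) → k} (hw : w ∈ Submodule.span k (Set.range ![p, v])) : eval w g = 0 := by
  rw [FanoScheme.range_vecCons_pair, Submodule.mem_span_pair] at hw
  obtain ⟨s, t, rfl⟩ := hw
  have h := FanoScheme.aeval_eq_zero_of_lineRestrict_eq_zero hg s t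
  rwa [MvPolynomial.aeval_eq_eval] at h

/-- **Through every closed point of `X = V₊(F₁, …, F_r) ⊆ ℙᴺ_k` passes a line of `X`
(Esnault–Levine–Viehweg, Lemma 4.2 a) for `l = 1` / Lemma 1.1 for `s = 0`, at the level of the
tree's schemes).** Let `k` be algebraically closed, `i : X ↪ ℙᴺ_k` a closed `k`-immersion of a
`k`-scheme locally of finite type whose image is the common zero locus `V₊(F₁, …, F_r)` of forms of
positive degrees `dⱼ` with `Σⱼ dⱼ ≤ N - 1`. Then every closed point `x` of `X` lies on a line of
`X`: there is a line point `z` (`IsLinePoint N i z`: `dim closure {z} = 1`, `i(closure {z})` a line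
`V₊(L₁, …, L_{N-1})` of `ℙᴺ`) with `x ∈ closure {z}`. Assembly: `x` underlies a `k`-point with
homogeneous coordinates `p` (`exists_algPoints_pt_eq`, `ProjectiveSpace.exists_eq_pointOfVec`),
the coordinate statement `exists_linearIndependent_lineRestrict_eq_zero` gives `v` with every `Fⱼ`
vanishing identically on `span(p, v)`, the `N - 1` coordinate forms cutting out `span(p, v)` contain
the `Fⱼ` in their ideal (`exists_linearForms_forall_mem_ideal_span`), so the line they define lies
on `i(X)` and is the image of a line point (`exists_isLinePoint_of_zeroLocus_subset`,
`Motives/LinesInProjectiveSpace`). [cite: EsnaultLevineViehweg1997, Lemma 4.2 a) (l = 1) and Lemma 1.1 (s = 0)] -/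
theorem exists_isLinePoint_of_isClosed [IsAlgClosed k] {X : SchemeOver k} [LocallyOfFiniteType X.hom]
    (i : X ⟶ projectiveSpace N k) [IsClosedImmersion i.left] {ι : Type*} [Fintype ι]
    (F : ι → MvPolynomial (Fin (N + 1)) k) (d : ι → ℕ) (hF : ∀ j, (F j).IsHomogeneous (d j))
    (hd : ∀ j, 0 < d j) (hsum : ∑ j, d j + 1 ≤ N)
    (hV : letI := MvPolynomial.gradedAlgebra (σ := Fin (N + 1)) (R := k)
      Set.range i.left.base =
        ProjectiveSpectrum.zeroLocus (MvPolynomial.homogeneousSubmodule (Fin (N + 1)) k)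
          (Set.range F))
    {x : ↥X.left} (hx : IsClosed ({x} : Set ↥X.left)) :
    ∃ z : ↥X.left, IsLinePoint N i z ∧ x ∈ closure {z} := by
  classical
  letI := MvPolynomial.gradedAlgebra (σ := Fin (N + 1)) (R := k)
  have hN : 1 ≤ N := by omega
  -- homogeneous coordinates of the closed point `x`
  obtain ⟨P, hPx⟩ := exists_algPoints_pt_eq (X := X) hx
  obtain ⟨p, hp, hQ⟩ := ProjectiveSpace.exists_eq_pointOfVec (AlgPoints.map i P)
  have hix : i.left.base x = (ProjectiveSpace.pointOfVec k p hp).pt := by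
    rw [← hQ, AlgPoints.pt_map, hPx]
  -- every `F j` vanishes at `p`
  have hmemV : (ProjectiveSpace.pointOfVec k p hp).pt ∈
      ProjectiveSpectrum.zeroLocus (MvPolynomial.homogeneousSubmodule (Fin (N + 1)) k) (Set.range F) := by
    rw [← hix, ← hV]
    exact ⟨x, rfl⟩
  have hFp : ∀ j, eval p (F j) = 0 := by
    intro j
    have hj : (ProjectiveSpace.pointOfVec k p hp).pt ∈ ProjectiveSpectrum.zeroLocus (MvPolynomial.homogeneousSubmodule (Fin (N + 1)) k) {F j} :=
      (ProjectiveSpectrum.mem_zeroLocus _ _ _).mpr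
        ((Set.singleton_subset_iff.mpr (Set.mem_range_self j : F j ∈ Set.range F)).trans
          ((ProjectiveSpectrum.mem_zeroLocus _ _ _).mp hmemV))
    have h := (ProjectiveSpace.pt_pointOfVec_mem_zeroLocus_iff p hp (hd j)
      ((mem_homogeneousSubmodule _ _).mpr (hF j))).mp hj
    rwa [MvPolynomial.aeval_eq_eval] at h
  -- a line of `V₊(F)` through `[p]`, in coordinates
  obtain ⟨v, hpv, hFpv⟩ := exists_linearIndependent_lineRestrict_eq_zero F d hF hsum hp hFp
  -- the `N - 1` linear forms cutting out `span(p, v)`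
  obtain ⟨t, L, htu, hL, hLhom, hFL, hLvan⟩ :=
    exists_linearForms_forall_mem_ideal_span F hpv fun j w hw =>
      eval_eq_zero_of_lineRestrict_eq_zero (hFpv j) hw
  obtain rfl : t = N - 1 := by omega
  -- the line `V₊(L)` lies on `i(X) = V₊(F)`
  have hsub : ProjectiveSpectrum.zeroLocus (MvPolynomial.homogeneousSubmodule (Fin (N + 1)) k) (Set.range L) ⊆ Set.range i.left.base := by
    intro q hq
    have hqL := (ProjectiveSpectrum.mem_zeroLocus _ _ _).mp hq
    have hspan : Ideal.span (Set.range L) ≤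
        (ProjectiveSpectrum.asHomogeneousIdeal (𝒜 := (MvPolynomial.homogeneousSubmodule (Fin (N + 1)) k)) q).toIdeal := Ideal.span_le.mpr hqL
    have hq' : (q : ↥(projectiveSpace N k).left) ∈
        ProjectiveSpectrum.zeroLocus (MvPolynomial.homogeneousSubmodule (Fin (N + 1)) k) (Set.range F) :=
      (ProjectiveSpectrum.mem_zeroLocus _ _ _).mpr (by
        rintro _ ⟨j, rfl⟩
        exact hspan (hFL j))
    have hq'' : (q : ↥(projectiveSpace N k).left) ∈ Set.range i.left.base := by
      rw [hV]
      exact hq'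
    exact hq''
  obtain ⟨z, hz, himg⟩ := exists_isLinePoint_of_zeroLocus_subset i hN L hL hLhom hsub
  refine ⟨z, hz, ?_⟩
  -- `x` lies on that line: `[p] ∈ V₊(L)` because the `L_j` vanish on `span(p, v) ∋ p`
  have hpt : i.left.base x ∈ ProjectiveSpectrum.zeroLocus (MvPolynomial.homogeneousSubmodule (Fin (N + 1)) k) (Set.range L) := by
    rw [hix]
    refine (ProjectiveSpectrum.mem_zeroLocus _ _ _).mpr ?_
    rintro _ ⟨j, rfl⟩
    have hj : (ProjectiveSpace.pointOfVec k p hp).pt ∈ ProjectiveSpectrum.zeroLocus (MvPolynomial.homogeneousSubmodule (Fin (N + 1)) k) {L j} := by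
      refine (ProjectiveSpace.pt_pointOfVec_mem_zeroLocus_iff p hp one_pos
        ((mem_homogeneousSubmodule _ _).mpr (hLhom j))).mpr ?_
      rw [MvPolynomial.aeval_eq_eval]
      exact hLvan j p (Submodule.subset_span ⟨0, rfl⟩)
    exact Set.singleton_subset_iff.mp ((ProjectiveSpectrum.mem_zeroLocus _ _ _).mp hj)
  rw [← himg] at hpt
  obtain ⟨x', hx', hxx'⟩ := hpt
  rwa [← i.left.isClosedEmbedding.injective hxx']

/-- **Lines through every closed point of a scheme cut out by forms of small degree**
(`IsCutOutBy`, `Motives/CompleteIntersection`): for `X` reduced, locally of finite type over an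
algebraically closed field and cut out in `ℙᴺ_k` by forms of positive degrees `dⱼ` with
`Σⱼ dⱼ ≤ N - 1`, some (any) closed `k`-immersion `i : X ↪ ℙᴺ_k` with image `V₊(F)` makes every
closed point lie on a line of `X`. [cite: EsnaultLevineViehweg1997, Lemma 4.2 a) (l = 1)] -/
theorem exists_forall_isLinePoint_of_isCutOutBy [IsAlgClosed k] {X : SchemeOver k}
    [LocallyOfFiniteType X.hom] {ι : Type*} [Fintype ι]
    {F : ι → MvPolynomial (Fin (N + 1)) k} {d : ι → ℕ} (hF : ∀ j, (F j).IsHomogeneous (d j))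
    (hd : ∀ j, 0 < d j) (hsum : ∑ j, d j + 1 ≤ N) (hX : IsCutOutBy N F X) :
    letI := MvPolynomial.gradedAlgebra (σ := Fin (N + 1)) (R := k)
    ∃ i : X ⟶ projectiveSpace N k, IsClosedImmersion i.left ∧
      Set.range i.left.base =
        ProjectiveSpectrum.zeroLocus (MvPolynomial.homogeneousSubmodule (Fin (N + 1)) k)
          (Set.range F) ∧
        ∀ x : ↥X.left, IsClosed ({x} : Set ↥X.left) →
          ∃ z : ↥X.left, IsLinePoint N i z ∧ x ∈ closure {z} := by
  letI := MvPolynomial.gradedAlgebra (σ := Fin (N + 1)) (R := k)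
  obtain ⟨-, i, hi, hV⟩ := hX
  haveI := hi
  exact ⟨i, hi, hV, fun x hx => exists_isLinePoint_of_isClosed i F d hF hd hsum hV hx⟩

/-- **Lines through every closed point of a smooth complete intersection of small degree**
(`IsSmoothCompleteIntersection m d X`, `Motives/CompleteIntersection`; e.g. the `(2,3)` sixfolds in
`ℙ⁸` of route `HodgeConjecture/schlafli-minus-five`: `2 + 3 + 1 ≤ 8`): over an algebraically
closed field, if `Σ_a d_a + 1 ≤ m + c` then for the cutting-out closed immersion
`i : X ↪ ℙ^{m+c}_k` every closed point of `X` lies on a line of `X` (`IsLinePoint (m + c) i z`,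
`x ∈ closure {z}`) — the scheme-level form of ELV Lemma 4.2 a) for `l = 1` on the carriers of the
named fact `EsnaultLevineViehweg1997_chowGroup_rank_le_one`.
[cite: EsnaultLevineViehweg1997, Lemma 4.2 a) (l = 1)] -/
theorem exists_forall_isLinePoint_of_isSmoothCompleteIntersection {k : Type u} [Field k]
    [IsAlgClosed k] {m c : ℕ} {d : Fin c → ℕ} {X : SchemeOver k}
    (hX : IsSmoothCompleteIntersection m d X) (hsum : ∑ a, d a + 1 ≤ m + c) :
    letI := MvPolynomial.gradedAlgebra (σ := Fin (m + c + 1)) (R := k)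
    ∃ (F : Fin c → MvPolynomial (Fin (m + c + 1)) k) (i : X ⟶ projectiveSpace (m + c) k),
      (∀ a, (F a).IsHomogeneous (d a)) ∧ IsClosedImmersion i.left ∧
        Set.range i.left.base = ProjectiveSpectrum.zeroLocus
          (MvPolynomial.homogeneousSubmodule (Fin (m + c + 1)) k) (Set.range F) ∧
          ∀ x : ↥X.left, IsClosed ({x} : Set ↥X.left) →
            ∃ z : ↥X.left, IsLinePoint (m + c) i z ∧ x ∈ closure {z} := by
  obtain ⟨hsp, F, hF, hd, -, hcut⟩ := hX
  haveI := hsp.smoothOfRelativeDimension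
  haveI : Smooth X.hom := SmoothOfRelativeDimension.smooth m _
  haveI : LocallyOfFiniteType X.hom := inferInstance
  obtain ⟨i, hi, hV, hlines⟩ := exists_forall_isLinePoint_of_isCutOutBy hF hd hsum hcut
  exact ⟨F, i, hF, hi, hV, hlines⟩

/-- **Every closed point of a `(2,3)` complete intersection in `ℙ⁸` lies on a line of it** — the
instance consumed by route `HodgeConjecture/schlafli-minus-five` (items `ChowZeroTrivial23`,
`LinesGenerate23`, in that route's rendering: a closed `ℂ`-immersion `ι : X ↪ ℙ⁸` with image
`V₊(Q, C)`, `deg Q = 2`, `deg C = 3`; here over any algebraically closed field and for any `X` locally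
of finite type, smoothness not needed): `2 + 3 + 1 ≤ 8`.
[cite: EsnaultLevineViehweg1997, Lemma 4.2 a) (l = 1)] -/
theorem exists_isLinePoint_of_isClosed_quadricCubic [IsAlgClosed k] {X : SchemeOver k}
    [LocallyOfFiniteType X.hom] (i : X ⟶ projectiveSpace 8 k) [IsClosedImmersion i.left]
    (Q C : MvPolynomial (Fin (8 + 1)) k) (hQ : Q.IsHomogeneous 2) (hC : C.IsHomogeneous 3)
    (hV : letI := MvPolynomial.gradedAlgebra (σ := Fin (8 + 1)) (R := k)
      Set.range i.left.base =
        ProjectiveSpectrum.zeroLocus (MvPolynomial.homogeneousSubmodule (Fin (8 + 1)) k) {Q, C})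
    {x : ↥X.left} (hx : IsClosed ({x} : Set ↥X.left)) :
    ∃ z : ↥X.left, IsLinePoint 8 i z ∧ x ∈ closure {z} := by
  refine exists_isLinePoint_of_isClosed i ![Q, C] ![2, 3] (fun j => by fin_cases j <;> assumption)
    (fun j => by fin_cases j <;> norm_num) (by norm_num [Fin.sum_univ_two]) ?_ hx
  have hr : Set.range ![Q, C] = {Q, C} := by
    ext G
    simp only [Set.mem_range, Set.mem_insert_iff, Set.mem_singleton_iff, Fin.exists_fin_two,
      Matrix.cons_val_zero, Matrix.cons_val_one, Matrix.cons_val_fin_one]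
    constructor
    · rintro (h | h)
      · exact Or.inl h.symm
      · exact Or.inr h.symm
    · rintro (h | h)
      · exact Or.inl h.symm
      · exact Or.inr h.symm
  rw [hV, hr]

end EmbeddedLines

/-! ### `r`-planes through every closed point of an embedded scheme (ELV Lemma 4.2 a), all `l`) -/

section EmbeddedPlanes

open Order

variable {k : Type u} [Field k] {N : ℕ}

/-- `FanoPlanes.planeRestrict w g = 0` makes `g` vanish at every vector of `span(w)`. [folklore] -/
theorem eval_eq_zero_of_planeRestrict_eq_zero {r : ℕ} {w : Fin (r + 1) → Fin (N + 1) → k}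
    {g : MvPolynomial (Fin (N + 1)) k} (hg : FanoPlanes.planeRestrict w g = 0)
    {q : Fin (N + 1) → k} (hq : q ∈ Submodule.span k (Set.range w)) : eval q g = 0 := by
  obtain ⟨c, rfl⟩ := (Submodule.mem_span_range_iff_exists_fun k).mp hq
  have h := eval_planeRestrict w g c
  rw [hg, map_zero] at h
  rw [← MvPolynomial.aeval_eq_eval]
  exact h.symm

/-- **Planes of `ℙᴺ` lying on `X` are planes of `X`** (the `r`-plane analogue of
`exists_isLinePoint_of_zeroLocus_subset` of `Motives/LinesInProjectiveSpace`): if the `r`-plane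
`V₊(L₁, …, L_{N-r})` of `ℙᴺ_k` (`r ≤ N`, the `Lⱼ` independent linear forms) lies in the image of
the closed immersion `i : X ↪ ℙᴺ_k`, it is the image of the closure of a point `z` of `X` with
`IsLinearSubspacePoint r N i z` (its dimension `r` is that of the generic point
`linearSubspacePoint L`, `Motives/ProjectiveSpaceLinearSubspaces`, transported by the closed
immersion). [cite: Hartshorne1977, I Ex. 2.11] -/
theorem exists_isLinearSubspacePoint_of_zeroLocus_subset {X : SchemeOver k}
    (i : X ⟶ projectiveSpace N k) [IsClosedImmersion i.left] {r : ℕ} (hr : r ≤ N)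
    (L : Fin (N - r) → MvPolynomial (Fin (N + 1)) k) (hL : LinearIndependent k L)
    (hhom : ∀ j, (L j).IsHomogeneous 1)
    (hsub : letI := MvPolynomial.gradedAlgebra (σ := Fin (N + 1)) (R := k)
      ProjectiveSpectrum.zeroLocus (MvPolynomial.homogeneousSubmodule (Fin (N + 1)) k)
        (Set.range L) ⊆ Set.range i.left.base) :
    letI := MvPolynomial.gradedAlgebra (σ := Fin (N + 1)) (R := k)
    ∃ z : ↥X.left, IsLinearSubspacePoint r N i z ∧
      ⇑i.left.base '' closure {z} =
        ProjectiveSpectrum.zeroLocus (MvPolynomial.homogeneousSubmodule (Fin (N + 1)) k)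
          (Set.range L) := by
  letI := MvPolynomial.gradedAlgebra (σ := Fin (N + 1)) (R := k)
  have ht : N - r ≤ N := Nat.sub_le N r
  obtain ⟨z, hz⟩ := hsub (linearSubspacePoint_mem_zeroLocus L hL hhom ht)
  have himg : ⇑i.left.base '' closure {z} =
      ProjectiveSpectrum.zeroLocus (MvPolynomial.homogeneousSubmodule (Fin (N + 1)) k)
        (Set.range L) := by
    rw [image_closure_singleton, hz, closure_linearSubspacePoint]
  refine ⟨z, ⟨?_, L, hL, hhom, himg⟩, himg⟩
  rw [← height_base_eq_of_isClosedImmersion' i.left z, hz, height_linearSubspacePoint,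
    show N - (N - r) = r by omega]

/-- **Through every closed point of `X = V₊(F₁, …, F_r) ⊆ ℙᴺ_k` passes an `l`-plane of `X`
(Esnault–Levine–Viehweg, Lemma 4.2 a), at the level of the tree's schemes).** Let `k` be
algebraically closed, `i : X ↪ ℙᴺ_k` a closed `k`-immersion of a `k`-scheme locally of finite type
with image `V₊(F₁, …, F_r)`, `deg Fⱼ = dⱼ ≥ 1`, and `l ≥ 1` with `Σⱼ C(dⱼ + l - 1, l) ≤ N - l`
(ELV's count (14), non-strict; e.g. from the printed hypothesis (13) via
`sum_choose_le_of_hypothesis13`). Then every closed point `x` of `X` lies on an `l`-plane of `X`: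
`∃ z, IsLinearSubspacePoint l N i z ∧ x ∈ closure {z}` (the coordinate statement
`exists_plane_through_point_of_le` transported exactly as for lines).
[cite: EsnaultLevineViehweg1997, Lemma 4.2 a)] -/
theorem exists_isLinearSubspacePoint_of_isClosed [IsAlgClosed k] {X : SchemeOver k}
    [LocallyOfFiniteType X.hom] (i : X ⟶ projectiveSpace N k) [IsClosedImmersion i.left]
    {ι : Type*} [Fintype ι] (F : ι → MvPolynomial (Fin (N + 1)) k) (d : ι → ℕ)
    (hF : ∀ j, (F j).IsHomogeneous (d j)) (hd : ∀ j, 0 < d j) {l : ℕ} (hl : 0 < l)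
    (hsum : ∑ j, Nat.choose (d j + (l - 1)) l + l ≤ N)
    (hV : letI := MvPolynomial.gradedAlgebra (σ := Fin (N + 1)) (R := k)
      Set.range i.left.base =
        ProjectiveSpectrum.zeroLocus (MvPolynomial.homogeneousSubmodule (Fin (N + 1)) k)
          (Set.range F))
    {x : ↥X.left} (hx : IsClosed ({x} : Set ↥X.left)) :
    ∃ z : ↥X.left, IsLinearSubspacePoint l N i z ∧ x ∈ closure {z} := by
  classical
  letI := MvPolynomial.gradedAlgebra (σ := Fin (N + 1)) (R := k)
  have hlN : l ≤ N := by omega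
  -- homogeneous coordinates of the closed point `x`
  obtain ⟨P, hPx⟩ := exists_algPoints_pt_eq (X := X) hx
  obtain ⟨p₀, hp₀, hQ⟩ := ProjectiveSpace.exists_eq_pointOfVec (AlgPoints.map i P)
  have hix : i.left.base x = (ProjectiveSpace.pointOfVec k p₀ hp₀).pt := by
    rw [← hQ, AlgPoints.pt_map, hPx]
  have hmemV : (ProjectiveSpace.pointOfVec k p₀ hp₀).pt ∈
      ProjectiveSpectrum.zeroLocus (MvPolynomial.homogeneousSubmodule (Fin (N + 1)) k)
        (Set.range F) := by
    rw [← hix, ← hV]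
    exact ⟨x, rfl⟩
  have hFp : ∀ j, eval p₀ (F j) = 0 := by
    intro j
    have hj : (ProjectiveSpace.pointOfVec k p₀ hp₀).pt ∈
        ProjectiveSpectrum.zeroLocus (MvPolynomial.homogeneousSubmodule (Fin (N + 1)) k) {F j} :=
      (ProjectiveSpectrum.mem_zeroLocus _ _ _).mpr
        ((Set.singleton_subset_iff.mpr (Set.mem_range_self j : F j ∈ Set.range F)).trans
          ((ProjectiveSpectrum.mem_zeroLocus _ _ _).mp hmemV))
    have h := (ProjectiveSpace.pt_pointOfVec_mem_zeroLocus_iff p₀ hp₀ (hd j)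
      ((mem_homogeneousSubmodule _ _).mpr (hF j))).mp hj
    rwa [MvPolynomial.aeval_eq_eval] at h
  -- an `l`-plane of `V₊(F)` through `[p₀]`, in coordinates
  obtain ⟨p, hp, hlast, hFp'⟩ := exists_plane_through_point_of_le F d hF hd hl hsum hp₀ hFp
  -- the `N - l` linear forms cutting out `span(p)`
  obtain ⟨t, L, htu, hL, hLhom, hFL, hLvan⟩ :=
    exists_linearForms_forall_mem_ideal_span F hp fun j q hq =>
      eval_eq_zero_of_planeRestrict_eq_zero (hFp' j) hq
  obtain rfl : t = N - l := by omega
  -- the plane `V₊(L)` lies on `i(X) = V₊(F)`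
  have hsub : ProjectiveSpectrum.zeroLocus (MvPolynomial.homogeneousSubmodule (Fin (N + 1)) k)
      (Set.range L) ⊆ Set.range i.left.base := by
    intro q hq
    have hqL := (ProjectiveSpectrum.mem_zeroLocus _ _ _).mp hq
    have hspan : Ideal.span (Set.range L) ≤
        (ProjectiveSpectrum.asHomogeneousIdeal
          (𝒜 := (MvPolynomial.homogeneousSubmodule (Fin (N + 1)) k)) q).toIdeal :=
      Ideal.span_le.mpr hqL
    have hq' : (q : ↥(projectiveSpace N k).left) ∈
        ProjectiveSpectrum.zeroLocus (MvPolynomial.homogeneousSubmodule (Fin (N + 1)) k)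
          (Set.range F) :=
      (ProjectiveSpectrum.mem_zeroLocus _ _ _).mpr (by
        rintro _ ⟨j, rfl⟩
        exact hspan (hFL j))
    have hq'' : (q : ↥(projectiveSpace N k).left) ∈ Set.range i.left.base := by
      rw [hV]
      exact hq'
    exact hq''
  obtain ⟨z, hz, himg⟩ := exists_isLinearSubspacePoint_of_zeroLocus_subset i hlN L hL hLhom hsub
  refine ⟨z, hz, ?_⟩
  -- `x` lies on that plane: `[p₀] ∈ V₊(L)` because the `L_j` vanish on `span(p) ∋ p₀ = p (last l)`
  have hpt : i.left.base x ∈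
      ProjectiveSpectrum.zeroLocus (MvPolynomial.homogeneousSubmodule (Fin (N + 1)) k)
        (Set.range L) := by
    rw [hix]
    refine (ProjectiveSpectrum.mem_zeroLocus _ _ _).mpr ?_
    rintro _ ⟨j, rfl⟩
    have hj : (ProjectiveSpace.pointOfVec k p₀ hp₀).pt ∈
        ProjectiveSpectrum.zeroLocus (MvPolynomial.homogeneousSubmodule (Fin (N + 1)) k) {L j} := by
      refine (ProjectiveSpace.pt_pointOfVec_mem_zeroLocus_iff p₀ hp₀ one_pos
        ((mem_homogeneousSubmodule _ _).mpr (hLhom j))).mpr ?_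
      rw [MvPolynomial.aeval_eq_eval]
      exact hLvan j p₀ (Submodule.subset_span ⟨Fin.last l, hlast⟩)
    exact Set.singleton_subset_iff.mp ((ProjectiveSpectrum.mem_zeroLocus _ _ _).mp hj)
  rw [← himg] at hpt
  obtain ⟨x', hx', hxx'⟩ := hpt
  rwa [← i.left.isClosedEmbedding.injective hxx']

/-- **`l`-planes through every closed point of a smooth complete intersection under ELV's printed
hypothesis (13)** (`IsSmoothCompleteIntersection m d X`, `Motives/CompleteIntersection`): over an
algebraically closed field, if all `d_a ≥ 2`, (`some d_a ≥ 3` or `c ≥ l`) and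
`Σ_a C(d_a + l, l + 1) ≤ m + c`, then for the cutting-out closed immersion `i : X ↪ ℙ^{m+c}_k`
every closed point of `X` lies on an `l`-plane of `X` (`IsLinearSubspacePoint l (m + c) i z`,
`x ∈ closure {z}`) — ELV Lemma 4.2 a) ("for each point `x ∈ X_v` there exists an `l`-plane
`H ∈ Gr_k(l; X_v)` which contains `x`") on the carriers of the named fact
`EsnaultLevineViehweg1997_chowGroup_rank_le_one`, under that fact's own hypotheses (first bullet).
[cite: EsnaultLevineViehweg1997, Lemma 4.2 a)] -/
theorem exists_forall_isLinearSubspacePoint_of_isSmoothCompleteIntersection {k : Type u} [Field k]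
    [IsAlgClosed k] {m c : ℕ} {d : Fin c → ℕ} {X : SchemeOver k}
    (hX : IsSmoothCompleteIntersection m d X) (hd : ∀ a, 2 ≤ d a) {l : ℕ} (hl : 0 < l)
    (h3 : (∃ a, 3 ≤ d a) ∨ l ≤ c) (h13 : ∑ a, Nat.choose (d a + l) (l + 1) ≤ m + c) :
    letI := MvPolynomial.gradedAlgebra (σ := Fin (m + c + 1)) (R := k)
    ∃ (F : Fin c → MvPolynomial (Fin (m + c + 1)) k) (i : X ⟶ projectiveSpace (m + c) k),
      (∀ a, (F a).IsHomogeneous (d a)) ∧ IsClosedImmersion i.left ∧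
        Set.range i.left.base = ProjectiveSpectrum.zeroLocus
          (MvPolynomial.homogeneousSubmodule (Fin (m + c + 1)) k) (Set.range F) ∧
          ∀ x : ↥X.left, IsClosed ({x} : Set ↥X.left) →
            ∃ z : ↥X.left, IsLinearSubspacePoint l (m + c) i z ∧ x ∈ closure {z} := by
  obtain ⟨hsp, F, hF, hd0, -, hcut⟩ := hX
  haveI := hsp.smoothOfRelativeDimension
  haveI : Smooth X.hom := SmoothOfRelativeDimension.smooth m _
  haveI : LocallyOfFiniteType X.hom := inferInstance
  obtain ⟨-, i, hi, hV⟩ := hcut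
  haveI := hi
  have hsum : ∑ a, Nat.choose (d a + (l - 1)) l + l ≤ m + c :=
    sum_choose_le_of_hypothesis13 d hd hl (by rwa [Fintype.card_fin]) h13
  exact ⟨F, i, hF, hi, hV, fun x hx =>
    exists_isLinearSubspacePoint_of_isClosed i F d hF hd0 hl hsum hV hx⟩

end EmbeddedPlanes

end EsnaultLevineViehweg

end Literature.AlgebraicGeometry.Motives

end
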